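import Summits.HodgeConjecture.HodgeConjecture.Theorems.F0P3StubS1Dec
import Summits.HodgeConjecture.HodgeConjecture.Theorems.F0P3StubS2HodgeTypes
import Summits.HodgeConjecture.HodgeConjecture.Theorems.HCCMUnconditionalOfGenericFloorV7
import Summits.HodgeConjecture.CorCM.Hyp413.A3Liu413FaceTypes
import Mathlib.RepresentationTheory.Intertwining
import HarnessLib

/-!
# FLOOR-0 P3 — THEOREMS-SIDE ASSEMBLY of line `F0_U3CohMultOne`: `hJ3a` from the three OPEN stubs S3 ∕ S4 ∕ S5, with S1 and S2 DISCHARGED BY NAME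

Cell hodgecm-mathlib (D-0151), FLOOR 0, crux item H413 = stmt-HodgeConjecture-24833; programme P3 «U3-mult», line `Cruxes/H413/Lines/F0_U3CohMultOne.lean`
v1.1 ∕ v1.2 (F0P3-plan (g0)).  Author F0P3-p01 (g0).  `--supports stmt-HodgeConjecture-24833 --as helper`.  Theorems only, no proof hole.

WHY A THEOREMS FILE: the line's kernel composition `multiplicity_le_one_printed_holds_of : S1 → S2 → S3 → S4 → S5 → HJ3aType` and its generic core
`rank_intertwiningMap_le_one_of_split` live in the `Cruxes/…/Lines` workfile, which no `Theorems/` file (in particular no floor file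
`HCCMUnconditionalOfGenericFloorV8`) may import.  This module carries the SAME kernel text into `Theorems/` and plugs in the two stubs that are
theorems tonight — ★ `F0P3StubS1Dec.stubS1_holds` (S1, p792863) and ★ `F0P3StubS2HodgeTypes.stubS2_holds` (S2, A-p09 (g18), p791898):

* §1 `left_eq_of_add_eq_add_of_disjoint`, `right_eq_of_add_eq_add_of_disjoint`, `rank_intertwiningMap_le_one_of_split` — the lead's generic linear
  algebra of the assembly, VERBATIM from the line's §3 (kernel-checked there; here under this file's namespace so that `Theorems/` can cite it);
* §2 **`hJ3a_of_S345 : <S3 body> → <S4 body> → <S5 body> → <HJ3aType body>`** — the bodies of `StubS3HolLineAt`, `StubS4AntiholLineAt`,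
  `StubS5HodgeTypeExclusionAt` and of `HJ3aType` (= the `hJ3a` binder of ★ `hc_cm_of_generic_floor_v7` ll. 76–80) pasted VERBATIM; S1, S2 by name;
* (no `H413` head here: composing with ★ `Hyp413Closing.H413_of_three_facts_flat` would import the route cone — the line's own head
  `H413_of_P3` does that inside `Cruxes/`; this module stays route-independent so a floor file can import it.)

The letter-level heads (`hJ3a_of_letters`, the lead's 22:23:53Z integration target) are these composed with the folds of S3 ∕ S4 (F0P3-p03) and S5
(F0P3-p02, ★ `F0P3StubS5Fold.stubS5_of_spectralProjection`) once their binder lists are final.  HC_CM is proved only modulo the printed citations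
until rung 0 closes; this file proves nothing about them.
[cite: Liu2021, proof of Prop. 4.13, l. 2121–2146] [cite: Rogawski1990, Thm. 14.6.4; §15.3] [cite: BorelWallach2000, VII 3.2; XIII 1.2]

## References
* [Liu2021] Y. Liu, *Fourier–Jacobi cycles and arithmetic relative trace formula*, Camb. J. Math. 9 (2021), Prop. 4.13 and its proof.
* [Rogawski1990] J. Rogawski, *Automorphic representations of unitary groups in three variables*, Ann. of Math. Stud. 123, Thm. 14.6.4, §15.3.
* [BorelWallach2000] A. Borel, N. Wallach, 2nd ed., AMS 2000, VII 3.2, XIII 1.2.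
* Tree: `Cruxes/H413/Lines/F0_U3CohMultOne.lean` (the text carried), ★ `Theorems/F0P3StubS1Dec`, ★ `Theorems/F0P3StubS2HodgeTypes`,
  ★ `CorCM/Hyp413/A3Liu413FaceTypes` (`datum413`), ★ `Theorems/H413CohFormsCarriers`.
-/

set_option autoImplicit false
-- the mandated namespace has the single-problem summit's repeated segment (`HodgeConjecture.HodgeConjecture`)
set_option linter.dupNamespace false

noncomputable section

namespace Summit.HodgeConjecture.HodgeConjecture.Cruxes.H413.F0P3HJ3aAssembly

open scoped TensorProduct Matrix
open NumberField NumberField.InfinitePlace IsDedekindDomain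
open HodgeCM.Model HodgeCM.Model.LiuIndex HodgeCM.Model.TowerCarrier
open Summit.HodgeConjecture.CorCM.Model
open Literature.AlgebraicGeometry.Motives (CMType AbelianVariety)
open Literature.AlgebraicGeometry.HodgeTheory Literature.NumberTheory.Automorphic.PicardCM
open Literature.AlgebraicGeometry.ShimuraVarieties Literature.AlgebraicGeometry.ShimuraVarieties.UnitaryCanonicalModel
open Literature.NumberTheory.ComplexMultiplication
open Literature.NumberTheory.Automorphic
open Literature.NumberTheory.Automorphic.Liu2021 Literature.NumberTheory.Automorphic.Liu2021.AppendixC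
open Literature.NumberTheory.Automorphic.Liu2021.Def411WeilCarriers (lineOf locF Rep)
open Summit.HodgeConjecture.CorCM.Transposition.OmegaTransport (realUnit)
open HodgeCM.Model.ArchSideTerm (e₁)
open Literature.NumberTheory.GelbartRogawski1991 Literature.NumberTheory.GelbartRogawski1991.UnitaryDualPair
open Literature.RepresentationTheory Literature.RepresentationTheory.Liu2021
open Summit.HodgeConjecture.CorCM
open Summit.HodgeConjecture.CorCM.Transposition
open Literature.NumberTheory.GelbartRogawski1991.OscillatorTripleDictionary (OccursInH1 IsIsoToOmega)
open Summit.HodgeConjecture.CorCM.Lines.A3Liu418 (Thm415AtFace EpsRigidAtFace)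
open Summit.HodgeConjecture.HodgeConjecture.Theses (HCCMUnconditional.HDel)
open MulAction
open Literature.Geometry.ComplexHyperbolic.BallModel (U21 x₀)
open Literature.NumberTheory.GelbartRogawski1991.OscillatorTripleDictionary (rhoTriple)
open Summit.HodgeConjecture.CorCM.Lines.A3Liu413 (datum413)
open Summit.HodgeConjecture.HodgeConjecture.Cruxes.H413.CohFormsCarriers

/-! ## §1 The generic linear algebra of the assembly (the line's §3, verbatim) -/

section Assembly

universe u

variable {k : Type*} [Field k] {G : Type*} [Monoid G]
variable {W H X : Type u} [AddCommGroup W] [Module k W] [AddCommGroup H] [Module k H] [AddCommGroup X] [Module k X]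

/-- Uniqueness of the decomposition along a disjoint pair of submodules (left component). [folklore] -/
theorem left_eq_of_add_eq_add_of_disjoint {A B : Submodule k X} (hAB : Disjoint A B) {a a' b b' : X}
    (ha : a ∈ A) (ha' : a' ∈ A) (hb : b ∈ B) (hb' : b' ∈ B) (h : a + b = a' + b') : a = a' := by
  have h1 : a - a' ∈ A := A.sub_mem ha ha'
  have h2 : a - a' ∈ B := by
    have hab : a - a' = b' - b := by
      rw [sub_eq_sub_iff_add_eq_add]
      exact h.trans (add_comm _ _)
    rw [hab]
    exact B.sub_mem hb' hb
  exact sub_eq_zero.mp ((Submodule.disjoint_def.mp hAB) _ h1 h2)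

/-- Uniqueness of the decomposition along a disjoint pair of submodules (right component). [folklore] -/
theorem right_eq_of_add_eq_add_of_disjoint {A B : Submodule k X} (hAB : Disjoint A B) {a a' b b' : X}
    (ha : a ∈ A) (ha' : a' ∈ A) (hb : b ∈ B) (hb' : b' ∈ B) (h : a + b = a' + b') : b = b' :=
  left_eq_of_add_eq_add_of_disjoint hAB.symm hb hb' ha ha' ((add_comm b a).trans (h.trans (add_comm a' b')))

/-- **The algebra of the assembly** (generic): if `H` embeds `G`-equivariantly into `A ⊔ B ⊆ X` with `A`, `B` disjoint and `G`-stable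
(S1, S2), the equivariant `A`-valued (resp. `B`-valued) linear maps out of `W` lie on a line (S3, S4), and one of the two families vanishes
(S5), then `rank_k Hom_G(W, H) ≤ 1`.  Proof: post-composition with the embedding is an injective linear map on intertwiners; its values split
uniquely into equivariant `A`- and `B`-components (projection along the disjoint stable pair); one component is zero, the other lies on the
given line; an injective linear map into a line has source of rank `≤ 1`. [folklore] -/
theorem rank_intertwiningMap_le_one_of_split
    (ρ : Representation k G W) (σ : Representation k G H) (R : Representation k G X) (A B : Submodule k X)
    (hS1 : ∃ dec : H →ₗ[k] X, Function.Injective dec ∧ (∀ x, dec x ∈ A ⊔ B) ∧ ∀ g x, dec (σ g x) = R g (dec x))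
    (hS2 : Disjoint A B ∧ (∀ (g : G) (x : X), x ∈ A → R g x ∈ A) ∧ (∀ (g : G) (x : X), x ∈ B → R g x ∈ B))
    (hS3 : ∃ ψ₀ : W →ₗ[k] X, ∀ ψ : W →ₗ[k] X,
      (∀ g w, ψ (ρ g w) = R g (ψ w)) → (∀ w, ψ w ∈ A) → ∃ r : k, ψ = r • ψ₀)
    (hS4 : ∃ ψ₀ : W →ₗ[k] X, ∀ ψ : W →ₗ[k] X,
      (∀ g w, ψ (ρ g w) = R g (ψ w)) → (∀ w, ψ w ∈ B) → ∃ r : k, ψ = r • ψ₀)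
    (hS5 : (∀ ψ : W →ₗ[k] X, (∀ g w, ψ (ρ g w) = R g (ψ w)) → (∀ w, ψ w ∈ A) → ψ = 0) ∨
      (∀ ψ : W →ₗ[k] X, (∀ g w, ψ (ρ g w) = R g (ψ w)) → (∀ w, ψ w ∈ B) → ψ = 0)) :
    Module.rank k (Representation.IntertwiningMap ρ σ) ≤ 1 := by
  obtain ⟨dec, hinj, hmem, heqv⟩ := hS1
  obtain ⟨hAB, hA, hB⟩ := hS2
  -- the sum map `A × B → X` is injective with range `A ⊔ B`
  let cop : (↥A × ↥B) →ₗ[k] X := A.subtype.coprod B.subtype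
  have hcop_apply : ∀ p : ↥A × ↥B, cop p = (p.1 : X) + (p.2 : X) := fun p => by
    simp only [cop, LinearMap.coprod_apply, Submodule.subtype_apply]
  have hcop_inj : Function.Injective cop := by
    rw [← LinearMap.ker_eq_bot, LinearMap.ker_eq_bot']
    rintro ⟨a, b⟩ hab
    rw [hcop_apply] at hab
    have hab' : (a : X) + b = 0 + 0 := by simpa using hab
    have ha0 : (a : X) = 0 := left_eq_of_add_eq_add_of_disjoint hAB a.2 A.zero_mem b.2 B.zero_mem hab'
    have hb0 : (b : X) = 0 := right_eq_of_add_eq_add_of_disjoint hAB a.2 A.zero_mem b.2 B.zero_mem hab'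
    ext
    · simpa using ha0
    · simpa using hb0
  have hrange : LinearMap.range cop = A ⊔ B := by
    simp only [cop, LinearMap.range_coprod, Submodule.range_subtype]
  let e : (↥A × ↥B) ≃ₗ[k] ↥(LinearMap.range cop) := LinearEquiv.ofInjective cop hcop_inj
  -- post-composition with `dec`, linear in the intertwiner
  let Φ : Representation.IntertwiningMap ρ σ →ₗ[k] (W →ₗ[k] X) :=
    (LinearMap.llcomp k W H X dec) ∘ₗ Representation.IntertwiningMap.toLinearMapl ρ σ
  have hΦapply : ∀ (φ : Representation.IntertwiningMap ρ σ) (w : W), Φ φ w = dec (φ w) := fun φ w => rfl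
  have hΦinj : Function.Injective Φ := by
    intro φ φ' h
    apply Representation.IntertwiningMap.ext
    ext w
    apply hinj
    have := LinearMap.congr_fun h w
    simpa [hΦapply] using this
  have hΦeqv : ∀ (φ : Representation.IntertwiningMap ρ σ) (g : G) (w : W), Φ φ (ρ g w) = R g (Φ φ w) := by
    intro φ g w
    rw [hΦapply, hΦapply, Representation.IntertwiningMap.isIntertwining ρ σ φ g w]
    exact heqv g (φ w)
  have hval : ∀ (φ : Representation.IntertwiningMap ρ σ) (w : W), Φ φ w ∈ LinearMap.range cop := by
    intro φ w
    rw [hrange]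
    exact hmem _
  -- the two components of `Φ φ` along `A ⊔ B = A ⊕ B`
  let comp : Representation.IntertwiningMap ρ σ → (W →ₗ[k] (↥A × ↥B)) := fun φ =>
    (e.symm : ↥(LinearMap.range cop) →ₗ[k] (↥A × ↥B)) ∘ₗ LinearMap.codRestrict (LinearMap.range cop) (Φ φ) (hval φ)
  let ψA : Representation.IntertwiningMap ρ σ → (W →ₗ[k] X) := fun φ => A.subtype ∘ₗ LinearMap.fst k ↥A ↥B ∘ₗ comp φ
  let ψB : Representation.IntertwiningMap ρ σ → (W →ₗ[k] X) := fun φ => B.subtype ∘ₗ LinearMap.snd k ↥A ↥B ∘ₗ comp φ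
  have hmemA : ∀ φ w, ψA φ w ∈ A := fun φ w => ((comp φ w).1).2
  have hmemB : ∀ φ w, ψB φ w ∈ B := fun φ w => ((comp φ w).2).2
  have hsum : ∀ φ w, ψA φ w + ψB φ w = Φ φ w := by
    intro φ w
    have h1 : cop (comp φ w) = Φ φ w := by
      have h2 := congrArg Subtype.val (e.apply_symm_apply (LinearMap.codRestrict (LinearMap.range cop) (Φ φ) (hval φ) w))
      rw [LinearEquiv.ofInjective_apply] at h2
      exact h2
    calc ψA φ w + ψB φ w = ((comp φ w).1 : X) + ((comp φ w).2 : X) := rfl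
      _ = cop (comp φ w) := (hcop_apply _).symm
      _ = Φ φ w := h1
  have heqvA : ∀ φ g w, ψA φ (ρ g w) = R g (ψA φ w) := by
    intro φ g w
    have h := hsum φ (ρ g w)
    rw [hΦeqv, ← hsum φ w, map_add] at h
    exact left_eq_of_add_eq_add_of_disjoint hAB (hmemA φ _) (hA g _ (hmemA φ w)) (hmemB φ _) (hB g _ (hmemB φ w)) h
  have heqvB : ∀ φ g w, ψB φ (ρ g w) = R g (ψB φ w) := by
    intro φ g w
    have h := hsum φ (ρ g w)
    rw [hΦeqv, ← hsum φ w, map_add] at h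
    exact right_eq_of_add_eq_add_of_disjoint hAB (hmemA φ _) (hA g _ (hmemA φ w)) (hmemB φ _) (hB g _ (hmemB φ w)) h
  -- the rank bound from a line containing the range of the injective `Φ`
  have key : ∀ ψ₀ : W →ₗ[k] X, (∀ φ, Φ φ ∈ k ∙ ψ₀) → Module.rank k (Representation.IntertwiningMap ρ σ) ≤ 1 := by
    intro ψ₀ hline
    have hcod : Function.Injective (LinearMap.codRestrict (k ∙ ψ₀) Φ hline) := by
      intro φ φ' h
      exact hΦinj (by simpa using congrArg Subtype.val h)
    refine (LinearMap.rank_le_of_injective _ hcod).trans ?_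
    refine (rank_span_le _).trans ?_
    simp
  rcases hS5 with h5 | h5
  · obtain ⟨ψ₀, hψ₀⟩ := hS4
    refine key ψ₀ fun φ => ?_
    have hA0 : ψA φ = 0 := h5 (ψA φ) (heqvA φ) (hmemA φ)
    obtain ⟨r, hr⟩ := hψ₀ (ψB φ) (heqvB φ) (hmemB φ)
    have hΦφ : Φ φ = ψB φ := by
      ext w
      rw [← hsum φ w, hA0, LinearMap.zero_apply, zero_add]
    rw [hΦφ, hr]
    exact Submodule.mem_span_singleton.mpr ⟨r, rfl⟩
  · obtain ⟨ψ₀, hψ₀⟩ := hS3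
    refine key ψ₀ fun φ => ?_
    have hB0 : ψB φ = 0 := h5 (ψB φ) (heqvB φ) (hmemB φ)
    obtain ⟨r, hr⟩ := hψ₀ (ψA φ) (heqvA φ) (hmemA φ)
    have hΦφ : Φ φ = ψA φ := by
      ext w
      rw [← hsum φ w, hB0, LinearMap.zero_apply, add_zero]
    rw [hΦφ, hr]
    exact Submodule.mem_span_singleton.mpr ⟨r, rfl⟩

end Assembly

/-! ## §2 `hJ3a` from S3 ∕ S4 ∕ S5, with S1 ∕ S2 by name -/

set_option synthInstance.maxHeartbeats 400000 in
set_option maxHeartbeats 8000000 in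
/-- **`hJ3a` MODULO THE THREE OPEN STUBS S3 ∕ S4 ∕ S5** (bodies verbatim as hypotheses; S1 := ★ `F0P3StubS1Dec.stubS1_holds`, S2 := ★
`F0P3StubS2HodgeTypes.stubS2_holds`): the conclusion is the body of `HJ3aType` = the `hJ3a` binder of ★ `hc_cm_of_generic_floor_v7` (ll. 76–80) VERBATIM.
Proof = the line's `multiplicity_le_one_printed_holds_of` (unfold to the face, `rank_intertwiningMap_le_one_of_split` at `ω_V(t)`, `H¹_B`, `rightRep`,
`holCotForms 𝔞₀`, `conj holCotForms 𝔞₀`). [cite: Liu2021, proof of Prop. 4.13, l. 2121–2146] [cite: Rogawski1990, Thm. 14.6.4; §15.3] -/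
theorem hJ3a_of_S345
    (h3 :
    ∀ (hDel : Literature.AlgebraicGeometry.ShimuraVarieties.UnitaryCanonicalModel.canonicalModel_exists_printed)
      (F : HodgeCM.CMField) [IsGalois ℚ F] (h6 : 6 ≤ Module.finrank ℚ F) {ι₁ : F →+* ℂ} (V : HodgeCM.HermSpace3 F ι₁) (a₀ : RealScalar F)
      (Φ : CMType F) (hΦ : ι₁ ∈ Φ.1) (i : (I V (repAt a₀) (muLiu ι₁ GramClass.rep))),
      3 ≤ (datum413 hDel F V a₀ Φ i).n → ∀ t : (datum413 hDel F V a₀ Φ i).AdmTriple,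
        ∃ ψ₀ : (datum413 hDel F V a₀ Φ i).omegaAt t →ₗ[ℂ] ((adelicDatum F V).Adelic → (Fin 2 → ℂ)),
          ∀ ψ : (datum413 hDel F V a₀ Φ i).omegaAt t →ₗ[ℂ] ((adelicDatum F V).Adelic → (Fin 2 → ℂ)),
            (∀ (g : ↥(HodgeCM.HermSpace3.adelicFin V)) (w : (datum413 hDel F V a₀ Φ i).omegaAt t),
                ψ ((datum413 hDel F V a₀ Φ i).rhoAt t g w) = rightRep F V g (ψ w)) →
              (∀ w, ψ w ∈ holCotForms (archFactorOf F V)) → ∃ r : ℂ, ψ = r • ψ₀)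
    (h4 :
    ∀ (hDel : Literature.AlgebraicGeometry.ShimuraVarieties.UnitaryCanonicalModel.canonicalModel_exists_printed)
      (F : HodgeCM.CMField) [IsGalois ℚ F] (h6 : 6 ≤ Module.finrank ℚ F) {ι₁ : F →+* ℂ} (V : HodgeCM.HermSpace3 F ι₁) (a₀ : RealScalar F)
      (Φ : CMType F) (hΦ : ι₁ ∈ Φ.1) (i : (I V (repAt a₀) (muLiu ι₁ GramClass.rep))),
      3 ≤ (datum413 hDel F V a₀ Φ i).n → ∀ t : (datum413 hDel F V a₀ Φ i).AdmTriple,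
        ∃ ψ₀ : (datum413 hDel F V a₀ Φ i).omegaAt t →ₗ[ℂ] ((adelicDatum F V).Adelic → (Fin 2 → ℂ)),
          ∀ ψ : (datum413 hDel F V a₀ Φ i).omegaAt t →ₗ[ℂ] ((adelicDatum F V).Adelic → (Fin 2 → ℂ)),
            (∀ (g : ↥(HodgeCM.HermSpace3.adelicFin V)) (w : (datum413 hDel F V a₀ Φ i).omegaAt t),
                ψ ((datum413 hDel F V a₀ Φ i).rhoAt t g w) = rightRep F V g (ψ w)) →
              (∀ w, ψ w ∈ (holCotForms (archFactorOf F V)).map (conjFun F V)) → ∃ r : ℂ, ψ = r • ψ₀)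
    (h5 :
    ∀ (hDel : Literature.AlgebraicGeometry.ShimuraVarieties.UnitaryCanonicalModel.canonicalModel_exists_printed)
      (F : HodgeCM.CMField) [IsGalois ℚ F] (h6 : 6 ≤ Module.finrank ℚ F) {ι₁ : F →+* ℂ} (V : HodgeCM.HermSpace3 F ι₁) (a₀ : RealScalar F)
      (Φ : CMType F) (hΦ : ι₁ ∈ Φ.1) (i : (I V (repAt a₀) (muLiu ι₁ GramClass.rep))),
      3 ≤ (datum413 hDel F V a₀ Φ i).n → ∀ t : (datum413 hDel F V a₀ Φ i).AdmTriple,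
        (∀ ψ : (datum413 hDel F V a₀ Φ i).omegaAt t →ₗ[ℂ] ((adelicDatum F V).Adelic → (Fin 2 → ℂ)),
            (∀ (g : ↥(HodgeCM.HermSpace3.adelicFin V)) (w : (datum413 hDel F V a₀ Φ i).omegaAt t),
                ψ ((datum413 hDel F V a₀ Φ i).rhoAt t g w) = rightRep F V g (ψ w)) →
              (∀ w, ψ w ∈ holCotForms (archFactorOf F V)) → ψ = 0) ∨
        (∀ ψ : (datum413 hDel F V a₀ Φ i).omegaAt t →ₗ[ℂ] ((adelicDatum F V).Adelic → (Fin 2 → ℂ)),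
            (∀ (g : ↥(HodgeCM.HermSpace3.adelicFin V)) (w : (datum413 hDel F V a₀ Φ i).omegaAt t),
                ψ ((datum413 hDel F V a₀ Φ i).rhoAt t g w) = rightRep F V g (ψ w)) →
              (∀ w, ψ w ∈ (holCotForms (archFactorOf F V)).map (conjFun F V)) → ψ = 0)) :
  ∀ (hDel : Literature.AlgebraicGeometry.ShimuraVarieties.UnitaryCanonicalModel.canonicalModel_exists_printed)
    (F : HodgeCM.CMField) [IsGalois ℚ F] (h6 : 6 ≤ Module.finrank ℚ F) {ι₁ : F →+* ℂ} (V : HodgeCM.HermSpace3 F ι₁) (a₀ : RealScalar F)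
    (Φ : CMType F) (hΦ : ι₁ ∈ Φ.1) (i : (I V (repAt a₀) (muLiu ι₁ GramClass.rep))),
    (((uniformOmegaRep (Summit.HodgeConjecture.CorCM.DelRec.exists_recordSystem_of_printed hDel) ⟨HodgeCM.CMField.K F⟩ ι₁ ⟨HodgeCM.HermSpace3.Hm V, HodgeCM.HermSpace3.isHermitian V, HodgeCM.HermSpace3.signature_ι₁ V, HodgeCM.HermSpace3.posDef_of_ne V⟩ Φ e₁ (frameD V) (frameD_real V) (frameD_ne V) (ιVE V) (2 * imagUnit (HodgeCM.CMField.K F))⁻¹ (fun _ _ => (Rep.update ↥(maximalRealSubfield (HodgeCM.CMField.K F)) (imagUnitSq (HodgeCM.CMField.K F)) (Rep.ofLineOf ↥(maximalRealSubfield (HodgeCM.CMField.K F)) (imagUnitSq (HodgeCM.CMField.K F))) (locF ↥(maximalRealSubfield (HodgeCM.CMField.K F)) (imagUnitSq (HodgeCM.CMField.K F)) (realUnit ⟨HodgeCM.CMField.K F⟩ (repAt a₀ (Sigma.fst i)).1 (repAt a₀ (Sigma.fst i)).2.1 (repAt a₀ (Sigma.fst i)).2.2)) (realUnit ⟨HodgeCM.CMField.K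 F⟩ (repAt a₀ (Sigma.fst i)).1 (repAt a₀ (Sigma.fst i)).2.1 (repAt a₀ (Sigma.fst i)).2.2) rfl)))).prop413Data ((liuDictionaryPin exists_isReal_hodgeModel_holds hodgePQ_independent_of_hodgeModel_holds BallQuotient.ballQuotientUniformised_holds (cmAbelianVarietyRealised_of_eigenbasis exists_isReal_hodgeModel_holds hodgePQ_independent_of_hodgeModel_holds cmAbelianVarietyEigenbasisRealised_holds) Literature.NumberTheory.Transcendental.arapura2012_cor_15_4_6_holds V (I V (repAt a₀) (muLiu ι₁ GramClass.rep)) (line V (repAt a₀) (muLiu ι₁ GramClass.rep)))).H).multiplicity_le_one_printed := by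
  intro hDel F _ h6 ι₁ V a₀ Φ hΦ i hn τ' t
  exact rank_intertwiningMap_le_one_of_split ((datum413 hDel F V a₀ Φ i).rhoAt t) ((datum413 hDel F V a₀ Φ i).rhoB τ') (rightRep F V)
    (holCotForms (archFactorOf F V)) ((holCotForms (archFactorOf F V)).map (conjFun F V))
    (F0P3StubS1Dec.stubS1_holds hDel F h6 V a₀ Φ hΦ i hn τ') (F0P3StubS2HodgeTypes.stubS2_holds F V)
    (h3 hDel F h6 V a₀ Φ hΦ i hn t) (h4 hDel F h6 V a₀ Φ hΦ i hn t) (h5 hDel F h6 V a₀ Φ hΦ i hn t)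

end Summit.HodgeConjecture.HodgeConjecture.Cruxes.H413.F0P3HJ3aAssembly

end
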